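import Summits.BirchSwinnertonDyer.BirchSwinnertonDyer.Theorems.CyclotomicUntwistSigmaLineFamilyDilatedPair
import Literature.NumberTheory.EllipticCurves.FormalGroupLawPadicProofs
import HarnessLib

/-!
# Route `CyclotomicUntwist`, crux K1 `PSRankOneLowerHalfAtThree` (stmt-BirchSwinnertonDyer-21580):
# the σ-LINE FAMILY — the THETA RELATION AT POINTS `σ(P+Q)σ(P−Q) = (x_Q − x_P)σ(P)²σ(Q)²` for every
# integral normalised odd solution, hence for every member `p⁻²σ_c(p²·)` of the dilated family at an
# arbitrary (e.g. additive) prime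

Cell `pub/bsd-wall` (D-0145 line `route-BirchSwinnertonDyer-CyclotomicUntwist`), seat `bsd-line-cycu-p1`
g4 (K1 base). THEOREMS ONLY (no definition, no named fact, no `sorry`); helper `--supports` K1 =
stmt-BirchSwinnertonDyer-21580. Sequel of `…SigmaLineFamilyDilatedPair.lean`. BSD is not proved by this
file and nothing here is evidence for or against K1/K2.

The analytic core of the QUADRATICITY of a sigma height `h_σ(P) = log_p den x(P) − 2 log_p σ(z(P))`
(Mazur–Stein–Tate 2006 §2.6–2.7: "`h` is quadratic because of property IV of `σ`") is the theta relation
AT POINTS of the kernel of reduction. The tree proves it for the CHOSEN Mazur–Tate series `σ_p` of a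
`ℤ`-integral model over `ℚ` (`padicSigmaAt_theta_of_thetaLHS_eq`). Here:

* §1 `theta_at_points` — the same over `ℚ_p`, for ANY `p`-integral elliptic `V/ℚ_p` and ANY integral
  normalised odd solution `σ` of the sigma equation (the formal identity `thetaLHS_eq_thetaRHS` holds for
  every normalised odd solution; evaluation at `(z(P), z(Q))` by the tree's `padicEval₂_thetaLHS/RHS` and
  `formalGroupLaw_padicEval_holds`); `theta_at_points_of_isMazurTateSigmaPair`.
* §2 `theta_at_points_dilated` — for the dilated model `V'` (`(p²,0,0,0) • V' = V`, `V` any `p`-integral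
  elliptic curve) and EVERY `c ∈ ℤ_p`, the member `formalSigma V' (p⁴c) = p⁻²σ_c(p²·)`
  (`isMazurTateSigmaPair_of_scaling`) satisfies the theta relation at all `P', Q' ∈ E₁(V')(ℚ_p)` — i.e.,
  read back on `V` (`x' = p⁴x`, `z' = z/p²`, `σ'(z') = p⁻²σ_c(z)`, the powers of `p` cancel:
  `X' = X` has weight `0`), `σ_c(z(P+Q))σ_c(z(P−Q)) = (x_Q − x_P)σ_c(z(P))²σ_c(z(Q))²` for all points of
  `V` with `v_p(z) ≥ 3`. With Néron's denominator law this is the parallelogram law of the `σ_c`-heights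
  on that locus (the census cell's caveat «Bernardi quadraticity of σ_c-heights at an additive prime»);
  the assembly into a bilinear datum is the tree's `exists_pairing_of_parallelogram` road, not redone here.
* `isElliptic_of_smul_eq` — `V'` is elliptic when `V` is.

References: Mazur–Tate, Duke Math. J. 62 (1991) Thm. 3.1; Mazur–Stein–Tate 2006 §2.6–2.7; Blakestad–Grant
2023 Prop. 14; Bernardi 1981 §1; Silverman AEC IV.1, VII.2.2. [cite: MazurTate1991, Thm. 3.1]
[cite: MazurSteinTate2006, §2.7] [cite: BlakestadGrant2023, Prop. 14]
-/

set_option autoImplicit false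
-- single-conjunct summit: `Summit.BirchSwinnertonDyer.BirchSwinnertonDyer.…` repeats the name by design
set_option linter.dupNamespace false

noncomputable section

open scoped Classical

open PowerSeries WeierstrassCurve Literature.NumberTheory.EllipticCurves
  Summit.BirchSwinnertonDyer.BirchSwinnertonDyer.Theorems.PSSigmaLineFamily
  Summit.BirchSwinnertonDyer.BirchSwinnertonDyer.Theorems.PSSigmaLineFamilyDilatedPair

namespace Summit.BirchSwinnertonDyer.BirchSwinnertonDyer.Theorems.PSSigmaLineFamilyThetaAtPoints

variable {p : ℕ} [Fact p.Prime] (V : WeierstrassCurve ℚ_[p]) [V.IsElliptic] [V.IsIntegral ℤ_[p]]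

/-! ### §1 The theta relation at `ℚ_p`-points for ANY integral normalised odd solution -/

/-- **The theta relation at points of the kernel of reduction, for any INTEGRAL normalised odd
solution of the sigma equation** (not only the chosen Mazur–Tate `σ_p`): for a `p`-integral elliptic
`V/ℚ_p`, `σ ∈ z + z²ℤ_p⟦z⟧` odd with `x + c = −D(Dσ/σ)`, and `P = (x₁,y₁)`, `Q = (x₂,y₂) ∈ E₁(ℚ_p)`
(`‖xᵢ‖ > 1`): `σ(z(P+Q))·σ(z(P−Q)) = (x₂ − x₁)·σ(z(P))²·σ(z(Q))²`. Proof = the tree's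
`padicSigmaAt_theta_of_thetaLHS_eq` over `ℚ_p` (formal identity `thetaLHS_eq_thetaRHS` — valid for every
normalised odd solution —, evaluated at `(z(P), z(Q))`, `F(z(P),z(Q)) = z(P+Q)` by
`formalGroupLaw_padicEval_holds`). [Mazur–Tate 1991, Thm. 3.1; Blakestad–Grant 2023, Prop. 14]
[cite: MazurTate1991, Thm. 3.1] [cite: BlakestadGrant2023, Prop. 14] -/
theorem theta_at_points {σ : ℚ_[p]⟦X⟧} {c : ℚ_[p]} (h0 : constantCoeff σ = 0) (h1 : coeff 1 σ = 1)
    (hodd : V.IsFormallyOdd σ) (hODE : V.SatisfiesSigmaODE σ c) (hint : IsPadicInt σ)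
    {x₁ y₁ x₂ y₂ : ℚ_[p]} (h₁ : V.toAffine.Nonsingular x₁ y₁) (h₂ : V.toAffine.Nonsingular x₂ y₂)
    (hx₁ : 1 < ‖x₁‖) (hx₂ : 1 < ‖x₂‖) :
    padicEval σ (V.formalParameter (.some x₁ y₁ h₁ + .some x₂ y₂ h₂)) *
        padicEval σ (V.formalParameter (.some x₁ y₁ h₁ - .some x₂ y₂ h₂)) =
      (x₂ - x₁) * padicEval σ (-x₁ / y₁) ^ 2 * padicEval σ (-x₂ / y₂) ^ 2 := by
  -- adapted from Literature/NumberTheory/EllipticCurves/CanonicalPAdicHeightSigmaThetaProofs.lean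
  have hΘ := V.thetaLHS_eq_thetaRHS h0 h1 hodd hODE
  have hFadd := formalGroupLaw_padicEval_holds p V
  set P : V.toAffine.Point := .some x₁ y₁ h₁ with hPdef
  set Q : V.toAffine.Point := .some x₂ y₂ h₂ with hQdef
  have hnQ : -Q = .some x₂ (V.toAffine.negY x₂ y₂) ((Affine.nonsingular_neg ..).mpr h₂) := by
    rw [hQdef, Affine.Point.neg_some]
  have hkP : V.IsInReductionKernel P := hx₁
  have hkQ : V.IsInReductionKernel Q := hx₂
  have hknQ : V.IsInReductionKernel (-Q) := by rw [hnQ]; exact hx₂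
  obtain ⟨hy₁, hu0, hu1, -, -⟩ := V.param_facts h₁.1 hx₁
  obtain ⟨hy₂, hv0, hv1, -, -⟩ := V.param_facts h₂.1 hx₂
  set u : ℚ_[p] := -x₁ / y₁ with hudef
  set v : ℚ_[p] := -x₂ / y₂ with hvdef
  have hzP : V.formalParameter P = u := rfl
  have hzQ : V.formalParameter Q = v := rfl
  have hznQ : V.formalParameter (-Q) = padicEval V.formalNeg v := by
    rw [hnQ, V.padicEval_formalNeg_eq h₂.1 hx₂]; rfl
  have hadd : padicEval₂ V.formalGroupLaw u v = V.formalParameter (P + Q) := by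
    rw [← hzP, ← hzQ]; exact hFadd _ _ hkP hkQ
  have hsub : padicEval₂ V.formalGroupLaw u (padicEval V.formalNeg v) = V.formalParameter (P - Q) := by
    rw [← hzP, ← hznQ, sub_eq_add_neg]; exact hFadd _ _ hkP hknQ
  have hXu : padicEval V.formalXMulSq u = x₁ * u ^ 2 := V.padicEval_formalXMulSq_eq h₁.1 hx₁
  have hXv : padicEval V.formalXMulSq v = x₂ * v ^ 2 := V.padicEval_formalXMulSq_eq h₂.1 hx₂
  have key := congrArg (fun G => padicEval₂ G u v) hΘ
  rw [padicEval₂_thetaLHS hint hu1 hv1, padicEval₂_thetaRHS hint hu1 hv1, hadd, hsub, hXu, hXv] at key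
  have huv : u ^ 2 * v ^ 2 ≠ 0 := mul_ne_zero (pow_ne_zero 2 hu0) (pow_ne_zero 2 hv0)
  apply mul_right_cancel₀ huv
  linear_combination key

/-- The same for a Mazur–Tate pair (the tree's receptacle). [cite: MazurTate1991, Thm. 3.1] -/
theorem theta_at_points_of_isMazurTateSigmaPair {σ : ℚ_[p]⟦X⟧} {c : ℚ_[p]} (h : V.IsMazurTateSigmaPair σ c)
    {x₁ y₁ x₂ y₂ : ℚ_[p]} (h₁ : V.toAffine.Nonsingular x₁ y₁) (h₂ : V.toAffine.Nonsingular x₂ y₂)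
    (hx₁ : 1 < ‖x₁‖) (hx₂ : 1 < ‖x₂‖) :
    padicEval σ (V.formalParameter (.some x₁ y₁ h₁ + .some x₂ y₂ h₂)) *
        padicEval σ (V.formalParameter (.some x₁ y₁ h₁ - .some x₂ y₂ h₂)) =
      (x₂ - x₁) * padicEval σ (-x₁ / y₁) ^ 2 * padicEval σ (-x₂ / y₂) ^ 2 :=
  theta_at_points V h.constantCoeff_eq h.coeff_one_eq h.odd h.ode (isPadicInt_iff_coeff.mpr h.norm_coeff_le)
    h₁ h₂ hx₁ hx₂

/-! ### §2 The dilated family: theta at points for `formalSigma V' (p⁴c)`, every `c ∈ ℤ_p` -/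

omit [V.IsIntegral ℤ_[p]] in
/-- A model `V'` with `vc • V' = V` is elliptic when `V` is (`Δ(vc • V') = u⁻¹² Δ(V')`). [folklore] -/
theorem isElliptic_of_smul_eq (V' : WeierstrassCurve ℚ_[p]) (vc : VariableChange ℚ_[p]) (hV : vc • V' = V) :
    V'.IsElliptic := by
  have hΔ : V.Δ = (vc.u⁻¹ : ℚ_[p]ˣ) ^ 12 * V'.Δ := by rw [← hV, variableChange_Δ]
  have hV0 : V.Δ ≠ 0 := V.isUnit_Δ.ne_zero
  rw [WeierstrassCurve.isElliptic_iff]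
  refine (Ne.isUnit ?_)
  intro h0
  exact hV0 (by rw [hΔ, h0, mul_zero])

/-- **THETA AT POINTS FOR THE WHOLE DILATED FAMILY.** For a `p`-integral elliptic `V/ℚ_p` (ANY reduction
type), a dilated model `V'` (`(p²,0,0,0) • V' = V`), every `c ∈ ℤ_p` and all points
`P' = (x₁,y₁)`, `Q' = (x₂,y₂) ∈ E₁(V')(ℚ_p)` (i.e. points of `V` with `v_p(z) ≥ 3`, read in `V'` via
`x' = p⁴x`, `y' = p⁶y`, `z' = z/p²`): the member `σ' = formalSigma V' (p⁴c) = p⁻²σ_c(p²·)` satisfies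
`σ'(z'(P'+Q'))σ'(z'(P'−Q')) = (x₂ − x₁)σ'(z'(P'))²σ'(z'(Q'))²` — the pointwise theta relation that makes
`σ_c`-heights quadratic (Mazur–Stein–Tate 2006 §2.6–2.7), at an additive prime.
[Mazur–Tate 1991, Thm. 3.1; Bernardi 1981, §1] [cite: MazurTate1991, Thm. 3.1] [cite: MazurSteinTate2006, §2.7] -/
theorem theta_at_points_dilated (V' : WeierstrassCurve ℚ_[p]) (vc : VariableChange ℚ_[p])
    (hu : (vc.u : ℚ_[p]) = (p : ℚ_[p]) ^ 2) (hr : vc.r = 0) (hs : vc.s = 0) (ht : vc.t = 0) (hV : vc • V' = V)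
    {c : ℚ_[p]} (hc : ‖c‖ ≤ 1)
    {x₁ y₁ x₂ y₂ : ℚ_[p]} (h₁ : V'.toAffine.Nonsingular x₁ y₁) (h₂ : V'.toAffine.Nonsingular x₂ y₂)
    (hx₁ : 1 < ‖x₁‖) (hx₂ : 1 < ‖x₂‖) :
    padicEval (V'.formalSigma ((p : ℚ_[p]) ^ 4 * c)) (V'.formalParameter (.some x₁ y₁ h₁ + .some x₂ y₂ h₂)) *
        padicEval (V'.formalSigma ((p : ℚ_[p]) ^ 4 * c)) (V'.formalParameter (.some x₁ y₁ h₁ - .some x₂ y₂ h₂)) =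
      (x₂ - x₁) * padicEval (V'.formalSigma ((p : ℚ_[p]) ^ 4 * c)) (-x₁ / y₁) ^ 2 *
        padicEval (V'.formalSigma ((p : ℚ_[p]) ^ 4 * c)) (-x₂ / y₂) ^ 2 := by
  haveI : V'.IsElliptic := isElliptic_of_smul_eq V V' vc hV
  haveI : V'.IsIntegral ℤ_[p] := isIntegral_of_scaling V V' vc hu hr hs ht hV
  exact theta_at_points_of_isMazurTateSigmaPair V' (isMazurTateSigmaPair_of_scaling V V' vc hu hr hs ht hV hc)
    h₁ h₂ hx₁ hx₂

end Summit.BirchSwinnertonDyer.BirchSwinnertonDyer.Theorems.PSSigmaLineFamilyThetaAtPoints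

end
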